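import Literature.NumberTheory.LFunctions.WeilCombNormLowerBound
import HarnessLib

/-!
# The `L²` norm of the `ζ`-mollified comb of a complex resonator from below

Topic `Literature/NumberTheory/LFunctions`. The complex-resonator versions of
`Literature/NumberTheory/LFunctions/MollifiedCoefficientsMeanSquare.lean` and
`Literature/NumberTheory/LFunctions/WeilCombNormLowerBound.lean`. For a finitely supported
complex resonator `α : ℕ → ℂ` (`α_ℓ = 0` for `ℓ > L`, `α_ℓ ≠ 0` for some `1 ≤ ℓ ≤ L`), the
mollified coefficients `a_m = ∑_{k ∣ m, k ≤ M} α(m/k)/√k` and a bump `b₁` supported in `[-1, 1]`: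

* `Literature.NumberTheory.LFunctions.exists_sum_norm_sq_divisorConv_ge_complex` —
  `∑_{m ≤ X} ‖a_m‖² ≥ c log X - C` for `1 ≤ X ≤ M` (`c > 0`, `C ≥ 0` depending on `α`, `L`):
  `‖a_m‖² ≥ (Re a_m)²` resp. `(Im a_m)²`, and `Re a_m`, `Im a_m` are the mollified coefficients
  of the real resonators `Re α`, `Im α`, one of which is not identically zero on `[1, L]`;
* `Literature.NumberTheory.LFunctions.exists_integral_norm_sq_comb_ge_complex` —
  `(κ/M) ‖b₁‖₂² (c log(M/κ) - C) ≤ ‖g‖₂²` for the comb `g(u) = ∑_{m ≤ LM} a_m b₁((u - log m) M/κ)`,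
  `1 ≤ κ`, `8κ ≤ M` (the teeth `m ≤ M/(4κ)` are disjoint).

Everything is proved; no named facts.

## References

* K. Soundararajan, *Extreme values of zeta and L-functions*, Math. Ann. 342 (2008), §2.
* E. Bombieri, *Remarks on Weil's quadratic functional in the theory of prime numbers I* (2000), §4.
-/

noncomputable section

open Complex MeasureTheory Set Filter Finset
open scoped Real Topology

namespace Literature.NumberTheory.LFunctions

/-- **Mean square of the mollified coefficients of a complex resonator.** If `α : ℕ → ℂ`
vanishes above `L` and `α_ℓ ≠ 0` for some `1 ≤ ℓ ≤ L`, then there are `c > 0` and `C ≥ 0` such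
that for all `1 ≤ X ≤ M`, `c log X - C ≤ ∑_{m=1}^{X} ‖∑_{k ∣ m, k ≤ M} α(m/k)/√k‖²`.
[cite: Soundararajan2008Extreme, §2] -/
theorem exists_sum_norm_sq_divisorConv_ge_complex {α : ℕ → ℂ} {L : ℕ}
    (hα : ∀ m, L < m → α m = 0) (hne : ∃ ℓ, 1 ≤ ℓ ∧ ℓ ≤ L ∧ α ℓ ≠ 0) :
    ∃ c : ℝ, 0 < c ∧ ∃ C : ℝ, 0 ≤ C ∧ ∀ X M : ℕ, 1 ≤ X → X ≤ M →
      c * Real.log X - C ≤ ∑ m ∈ Finset.Icc 1 X,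
        ‖∑ k ∈ (Nat.divisors m).filter (· ≤ M), α (m / k) / (Real.sqrt k : ℂ)‖ ^ 2 := by
  -- `‖z‖² ≥ (Re z)²` and `‖z‖² ≥ (Im z)²`
  have hre2 : ∀ z : ℂ, z.re ^ 2 ≤ ‖z‖ ^ 2 := fun z ↦ by
    rw [Complex.sq_norm, sq]; exact Complex.re_sq_le_normSq z
  have him2 : ∀ z : ℂ, z.im ^ 2 ≤ ‖z‖ ^ 2 := fun z ↦ by
    rw [Complex.sq_norm, sq]; exact Complex.im_sq_le_normSq z
  -- the real and imaginary parts of the coefficients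
  have hre : ∀ m M : ℕ, (∑ k ∈ (Nat.divisors m).filter (· ≤ M), α (m / k) / (Real.sqrt k : ℂ)).re
      = ∑ k ∈ (Nat.divisors m).filter (· ≤ M), (α (m / k)).re / Real.sqrt k := fun m M ↦ by
    rw [Complex.re_sum]; simp only [Complex.div_ofReal_re]
  have him : ∀ m M : ℕ, (∑ k ∈ (Nat.divisors m).filter (· ≤ M), α (m / k) / (Real.sqrt k : ℂ)).im
      = ∑ k ∈ (Nat.divisors m).filter (· ≤ M), (α (m / k)).im / Real.sqrt k := fun m M ↦ by
    rw [Complex.im_sum]; simp only [Complex.div_ofReal_im]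
  by_cases hcase : ∃ ℓ, 1 ≤ ℓ ∧ ℓ ≤ L ∧ (α ℓ).re ≠ 0
  · -- `Re α` is a non-trivial real resonator
    obtain ⟨c, hc, C, hC, h⟩ := exists_sum_sq_divisorConv_ge (α := fun n ↦ (α n).re)
      (fun m hm ↦ by simp [hα m hm]) hcase
    refine ⟨c, hc, C, hC, fun X M hX hXM ↦ (h X M hX hXM).trans (Finset.sum_le_sum fun m _ ↦ ?_)⟩
    rw [← hre]
    exact hre2 _
  · -- otherwise `Im α` is
    push Not at hcase
    have hcase' : ∃ ℓ, 1 ≤ ℓ ∧ ℓ ≤ L ∧ (α ℓ).im ≠ 0 := by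
      obtain ⟨ℓ, h1, hL, hαℓ⟩ := hne
      refine ⟨ℓ, h1, hL, fun h0 ↦ hαℓ (Complex.ext ?_ ?_)⟩
      · simpa using hcase ℓ h1 hL
      · simpa using h0
    obtain ⟨c, hc, C, hC, h⟩ := exists_sum_sq_divisorConv_ge (α := fun n ↦ (α n).im)
      (fun m hm ↦ by simp [hα m hm]) hcase'
    refine ⟨c, hc, C, hC, fun X M hX hXM ↦ (h X M hX hXM).trans (Finset.sum_le_sum fun m _ ↦ ?_)⟩
    rw [← him]
    exact him2 _

/-- **`‖g‖₂² ≫ (κ/M) log(M/κ)` for the `ζ`-mollified comb of a complex resonator.** For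
`α : ℕ → ℂ` supported on `[1, L]` with `α_ℓ ≠ 0` for some `1 ≤ ℓ ≤ L`, and a Weil test function
`b₁` supported in `[-1, 1]`, there are `c > 0`, `C ≥ 0` such that for all `M` and `1 ≤ κ` with
`8κ ≤ M`,
`(κ/M) (∫ ‖b₁‖²) (c log(M/κ) - C) ≤ ∫ ‖∑_{m ≤ LM} a_m b₁((u - log m) M/κ)‖² du`,
`a_m = ∑_{k ∣ m, k ≤ M} α(m/k)/√k`. [cite: Soundararajan2008Extreme, §2] -/
theorem exists_integral_norm_sq_comb_ge_complex {α : ℕ → ℂ} {L : ℕ} (hα : ∀ m, L < m → α m = 0)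
    (hne : ∃ ℓ, 1 ≤ ℓ ∧ ℓ ≤ L ∧ α ℓ ≠ 0) {b₁ : ℝ → ℂ} (hb : IsWeilTest b₁)
    (hsupp : tsupport b₁ ⊆ Set.Icc (-1) 1) :
    ∃ c : ℝ, 0 < c ∧ ∃ C : ℝ, 0 ≤ C ∧ ∀ (M : ℕ) (κ : ℝ), 1 ≤ κ → 8 * κ ≤ M →
      κ / M * (∫ u, ‖b₁ u‖ ^ 2) * (c * Real.log (M / κ) - C)
        ≤ ∫ u, ‖∑ m ∈ Finset.range (L * M + 1),
            (∑ k ∈ (Nat.divisors m).filter (· ≤ M), α (m / k) / (Real.sqrt k : ℂ)) *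
              b₁ ((u - Real.log m) * ((M : ℝ) / κ))‖ ^ 2 := by
  obtain ⟨c, hc, C₀, hC₀, hms⟩ := exists_sum_norm_sq_divisorConv_ge_complex hα hne
  have hlog8 : 0 ≤ Real.log 8 := Real.log_nonneg (by norm_num)
  refine ⟨c, hc, C₀ + c * Real.log 8, by positivity, ?_⟩
  intro M κ hκ1 hκM
  obtain ⟨ℓ₁, hℓ₁1, hℓ₁L, -⟩ := hne
  have hL1 : 1 ≤ L := hℓ₁1.trans hℓ₁L
  have hκ0 : 0 < κ := by linarith
  have hM0 : (0 : ℝ) < M := by linarith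
  set lam : ℝ := (M : ℝ) / κ with hlam
  have hlam8 : 8 ≤ lam := by rw [hlam, le_div_iff₀ hκ0]; linarith
  have hlam0 : 0 < lam := by linarith
  -- the separated range `m ≤ m₀ = ⌊λ/4⌋`
  set m₀ : ℕ := ⌊lam / 4⌋₊ with hm₀
  have hm₀le : (m₀ : ℝ) ≤ lam / 4 := Nat.floor_le (by positivity)
  have hm₀ge : lam / 4 - 1 < m₀ := by
    have := Nat.lt_floor_add_one (lam / 4); rw [← hm₀] at this; linarith
  have hm₀2 : 1 ≤ m₀ := by
    have : (1 : ℝ) < m₀ := by linarith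
    exact_mod_cast this.le
  have hm₀M : m₀ ≤ M := by
    have h1 : (m₀ : ℝ) ≤ M := by
      calc (m₀ : ℝ) ≤ lam / 4 := hm₀le
        _ ≤ lam := by linarith
        _ ≤ M := by rw [hlam, div_le_iff₀ hκ0]; nlinarith
    exact_mod_cast h1
  have hm₀N : m₀ < L * M + 1 := by
    have : m₀ ≤ L * M := hm₀M.trans (Nat.le_mul_of_pos_left M hL1)
    omega
  have hsepl : 2 * ((m₀ : ℝ) + 1) < lam := by linarith
  -- the coefficients
  set a : ℕ → ℂ := fun m ↦ ∑ k ∈ (Nat.divisors m).filter (· ≤ M), α (m / k) / (Real.sqrt k : ℂ)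
    with ha
  have ha0 : a 0 = 0 := by simp [ha]
  -- separation of the teeth
  have hsep : ∀ m ∈ Finset.Icc 1 m₀, ∀ m' ∈ Finset.range (L * M + 1), m' ≠ m → m' ≠ 0 →
      2 / lam < |Real.log m' - Real.log m| := by
    intro m hm m' _ hne' hm'0
    obtain ⟨hm1, hmm₀⟩ := Finset.mem_Icc.1 hm
    exact abs_log_sub_log_gt_of_le hsepl hm1 hmm₀ (Nat.pos_of_ne_zero hm'0) hne'
  -- the two inputs
  have hteeth := integral_norm_sq_logComb_ge hb hsupp ha0 hm₀N hlam0 hsep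
  have hcoef := hms m₀ M hm₀2 hm₀M
  -- `log m₀ ≥ log λ - log 8`
  have hlogm₀ : Real.log lam - Real.log 8 ≤ Real.log m₀ := by
    have h1 : lam / 8 ≤ m₀ := by linarith
    rw [← Real.log_div hlam0.ne' (by norm_num)]
    exact Real.log_le_log (by positivity) h1
  have hB : 0 ≤ ∫ u, ‖b₁ u‖ ^ 2 := integral_nonneg fun u ↦ by positivity
  have hlaminv : lam⁻¹ = κ / M := by rw [hlam, inv_div]
  rw [hlaminv] at hteeth
  -- assemble
  have hchain : c * Real.log (M / κ) - (C₀ + c * Real.log 8) ≤ ∑ m ∈ Finset.Icc 1 m₀, ‖a m‖ ^ 2 := by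
    have : c * (Real.log lam - Real.log 8) ≤ c * Real.log m₀ :=
      mul_le_mul_of_nonneg_left hlogm₀ hc.le
    rw [← hlam]
    linarith
  calc κ / M * (∫ u, ‖b₁ u‖ ^ 2) * (c * Real.log (M / κ) - (C₀ + c * Real.log 8))
      ≤ κ / M * (∫ u, ‖b₁ u‖ ^ 2) * ∑ m ∈ Finset.Icc 1 m₀, ‖a m‖ ^ 2 :=
        mul_le_mul_of_nonneg_left hchain (by positivity)
    _ = (∑ m ∈ Finset.Icc 1 m₀, ‖a m‖ ^ 2) * (κ / M * ∫ u, ‖b₁ u‖ ^ 2) := by ring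
    _ ≤ _ := hteeth

end Literature.NumberTheory.LFunctions
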